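import Mathlib.Topology.Algebra.OpenSubgroup
import Literature.AnabelianGeometry.SemiGraphs.TemperedReconstructionReductionsProofs
import Literature.AnabelianGeometry.SemiGraphs.TemperedReconstructionVertexMapProofs
import Literature.AnabelianGeometry.SemiGraphs.TemperedEdgeLikeDistinct
import HarnessLib

/-!
# Semi-graphs of anabelioids, §3: Corollary 3.9, step (b) — a quasi-geometric homomorphism
# determines the map on edges (toward residual R2 of the reduction)

Mochizuki, *Semi-graphs of anabelioids*, Publ. RIMS **42** (2006), §3, Corollary 3.9, proof,
manuscript p. 42 [cite: MochizukiSemiAnbd2006, Cor 3.9 p.42]: "Similarly, by considering nontrivial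
intersections of maximal compact subgroups, one obtains [in light of the fact that, since `H` is
totally elevated and totally aloof, all of the edge-like subgroups of `π₁^temp(H)` are infinite] that
any quasi-geometric `φ : B^temp(G) → B^temp(H)` determines a map from the edges of `G` to the edges of
`H`".  Proof-only (no definitions): from Theorem 3.7 (i) `VerticialInjective`, (iv)
`MaximalCompactIffVerticial` and the edge analogue of (ii) `EdgeLikeDistinct` (abc-iut-L3-d2), for
GRAPHS `G`, `H` (Cor. 3.9's hypotheses: every edge closed) a quasi-geometric `φ` determines a unique
map `f_E` on edges such that every edge-like subgroup at `e` is carried onto an open subgroup of an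
edge-like subgroup at `f_E(e)`; the edge-like subgroups of `G` are nontrivial (aloof + elevated), so
they are nontrivial intersections of two distinct maximal compact subgroups (Thm. 3.7 (iv)) and
Definition 3.8 applies.  Companion of `TemperedReconstructionVertexMapProofs.lean` (vertices); the
compatibility of `f_E` with `f_V` (Thm. 3.7 (iii)) is not proved here.  Nothing here takes a side on
[IUTchIII] Cor. 3.12.
-/

open CategoryTheory Topology

namespace Literature.AnabelianGeometry.SemiGraphs

namespace ProfiniteSemiGraph

universe u

variable {𝒢 ℋ : ProfiniteSemiGraph.{u}}

/-- In a graph every edge is closed (two distinct branches, each abutting to a vertex).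
[cite: MochizukiSemiAnbd2006, §1 p.11] -/
theorem isClosedEdge_of_isGraph (h : 𝒢.graph.IsGraph) (e : 𝒢.graph.Edge) : 𝒢.graph.IsClosedEdge e := by
  obtain ⟨b₁, b₂, hne, h₁, h₂, -⟩ := 𝒢.graph.two_branches e
  obtain ⟨w₁, hw₁⟩ := Option.isSome_iff_exists.mp (h.abuts_isSome b₁)
  obtain ⟨w₂, hw₂⟩ := Option.isSome_iff_exists.mp (h.abuts_isSome b₂)
  exact SemiGraph.isClosedEdge_of_abuts hne h₁ h₂ hw₁ hw₂

/-- **The edge is determined** (edge analogue of Thm. 3.7 (ii), `EdgeLikeDistinct`): if `φ` maps `L`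
onto an open subgroup of an edge-like subgroup `L₂` at `e`, and `φ(L)` also lies in an edge-like
subgroup `L₂'` at `e'`, then `e = e'`. [cite: MochizukiSemiAnbd2006, Cor 3.9 p.42] -/
theorem edge_eq_of_mapsOnto_of_le (hED : EdgeLikeDistinct.{u}) (hℋ : ℋ.Thm37Hypotheses)
    {P : Type u} [Group P] (cℋ : TemperedPiChart ℋ) (φ : P →* cℋ.G) {L : Subgroup P}
    {e e' : ℋ.graph.Edge} {L₂ L₂' : Subgroup cℋ.G} (hL₂ : L₂ ∈ edgeLikeSubgroups cℋ e)
    (hL₂' : L₂' ∈ edgeLikeSubgroups cℋ e') (hmaps : MapsOntoOpenSubgroupOf φ L L₂)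
    (hle : L.map φ ≤ L₂') : e = e' := by
  have h1 : (L.map φ).relIndex L₂ ≠ 0 :=
    relIndex_ne_zero_of_mapsOnto φ (isCompact_of_mem_edgeLikeSubgroups cℋ hL₂) hmaps
  have h2 : L₂'.relIndex L₂ ≠ 0 := fun h0 => h1 (Subgroup.relIndex_eq_zero_of_le_left hle h0)
  by_contra hne
  exact h2 (hED ℋ hℋ cℋ e e' L₂ L₂' hL₂ hL₂' hne)

/-- In a graph of anabelioids satisfying the hypotheses of Cor. 3.9, every edge carries a NONTRIVIAL
edge-like subgroup ("since `H` is totally elevated and totally aloof, all of the edge-like subgroups of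
`π₁^temp(H)` are infinite", p. 42 — nontriviality suffices here): `ψ_v ∘ b_*` for a verticial
homomorphism `ψ_v` at a vertex of the edge. [cite: MochizukiSemiAnbd2006, Cor 3.9 p.42] -/
theorem exists_mem_edgeLikeSubgroups_ne_bot (h37i : VerticialInjective.{u}) (h𝒢 : Cor39Hypotheses 𝒢)
    (c : TemperedPiChart 𝒢) (e : 𝒢.graph.Edge) : ∃ L ∈ edgeLikeSubgroups c e, L ≠ ⊥ := by
  obtain ⟨b, v, hbe, hbv⟩ : ∃ (b : 𝒢.graph.Branch) (v : 𝒢.graph.Vertex),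
      𝒢.graph.edgeOf b = e ∧ 𝒢.graph.abuts b = some v := by
    obtain ⟨b₁, -, -, h₁, -, -⟩ := 𝒢.graph.two_branches e
    obtain ⟨v, hv⟩ := Option.isSome_iff_exists.mp (h𝒢.isGraph.abuts_isSome b₁)
    exact ⟨b₁, v, h₁, hv⟩
  subst hbe
  obtain ⟨⟨_, ψv, ⟨ev⟩, rfl⟩, hinj⟩ := h37i 𝒢 h𝒢.thm37Hypotheses c v
  let ψ : 𝒢.Ge (𝒢.graph.edgeOf b) →ₜ* c.G := ψv.comp (𝒢.brHom b v hbv)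
  have hψ : IsEdgeHom c (𝒢.graph.edgeOf b) ψ := isEdgeHom_comp_brHom c hbv ⟨ev⟩
  have hinjψ : Function.Injective ψ := (hinj ψv ⟨ev⟩).comp (h𝒢.isOfInjectiveType b v hbv)
  haveI : Infinite (𝒢.Gv v) := infinite_gv_of_isElevatedVertex (h𝒢.isTotallyElevated v)
  haveI : Nontrivial (𝒢.Ge (𝒢.graph.edgeOf b)) := nontrivial_ge_of_isAloofEdge hbv (h𝒢.isTotallyAloof _)
  refine ⟨ψ.toMonoidHom.range, ⟨ψ, hψ, rfl⟩, fun h0 => ?_⟩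
  obtain ⟨x, hx⟩ := exists_ne (1 : 𝒢.Ge (𝒢.graph.edgeOf b))
  have : ψ x ∈ ψ.toMonoidHom.range := ⟨x, rfl⟩
  rw [h0, Subgroup.mem_bot, ← map_one ψ] at this
  exact hx (hinjψ this)

/-- The image, under a quasi-geometric `φ`, of a nontrivial edge-like subgroup of a (closed) edge lies,
as an open subgroup, in an edge-like subgroup of a closed edge of `H` (Def. 3.8 + Thm. 3.7 (iv) on both
sides). [cite: MochizukiSemiAnbd2006, Cor 3.9 p.42] -/
theorem exists_edge_mapsOnto_of_isQuasiGeometric (h37iv : MaximalCompactIffVerticial.{u})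
    (h𝒢 : Cor39Hypotheses 𝒢) (hℋ : Cor39Hypotheses ℋ) (c𝒢 : TemperedPiChart 𝒢) (cℋ : TemperedPiChart ℋ)
    {φ : c𝒢.G →ₜ* cℋ.G} (hφ : IsQuasiGeometric φ) {e : 𝒢.graph.Edge} {L : Subgroup c𝒢.G}
    (hL : L ∈ edgeLikeSubgroups c𝒢 e) (hL0 : L ≠ ⊥) :
    ∃ (e' : ℋ.graph.Edge) (L₂ : Subgroup cℋ.G), L₂ ∈ edgeLikeSubgroups cℋ e' ∧
      MapsOntoOpenSubgroupOf φ.toMonoidHom L L₂ := by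
  obtain ⟨-, hint𝒢⟩ := h37iv 𝒢 h𝒢.thm37Hypotheses c𝒢
  obtain ⟨-, hintℋ⟩ := h37iv ℋ hℋ.thm37Hypotheses cℋ
  obtain ⟨K₁, H₁, hK₁, hH₁, hne, rfl⟩ :=
    (hint𝒢 L hL0).mpr ⟨e, isClosedEdge_of_isGraph h𝒢.isGraph e, hL⟩
  obtain ⟨K₂, H₂, hK₂, hH₂, hne₂, hnt₂, hmaps⟩ := hφ.inter K₁ H₁ hK₁ hH₁ hne hL0
  obtain ⟨e', -, hL₂⟩ := (hintℋ (K₂ ⊓ H₂) hnt₂).mp ⟨K₂, H₂, hK₂, hH₂, hne₂, rfl⟩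
  exact ⟨e', K₂ ⊓ H₂, hL₂, hmaps⟩

/-- **A quasi-geometric `φ` determines the map on edges** ([SemiAnbd] Cor. 3.9, proof, p. 42), from
Thm. 3.7 (i), (iv) and `EdgeLikeDistinct`: for graphs `G`, `H` as in Cor. 3.9 there is a unique
`f_E : E(G) → E(H)` such that every edge-like subgroup of `π₁^temp(G)` at `e` maps onto an open subgroup
of some edge-like subgroup of `π₁^temp(H)` at `f_E(e)`. [cite: MochizukiSemiAnbd2006, Cor 3.9 p.42] -/
theorem existsUnique_edgeMap_of_isQuasiGeometric (h37i : VerticialInjective.{u})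
    (h37iv : MaximalCompactIffVerticial.{u}) (hED : EdgeLikeDistinct.{u})
    (h𝒢 : Cor39Hypotheses 𝒢) (hℋ : Cor39Hypotheses ℋ) (c𝒢 : TemperedPiChart 𝒢)
    (cℋ : TemperedPiChart ℋ) (φ : c𝒢.G →ₜ* cℋ.G) (hφ : IsQuasiGeometric φ) :
    ∃! fE : 𝒢.graph.Edge → ℋ.graph.Edge,
      ∀ (e : 𝒢.graph.Edge) (L : Subgroup c𝒢.G), L ∈ edgeLikeSubgroups c𝒢 e →
        ∃ L₂ ∈ edgeLikeSubgroups cℋ (fE e), MapsOntoOpenSubgroupOf φ.toMonoidHom L L₂ := by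
  -- choose, for each edge, a nontrivial edge-like subgroup and the edge of its image
  choose L₀ hL₀ hL₀0 using fun e => exists_mem_edgeLikeSubgroups_ne_bot h37i h𝒢 c𝒢 e
  choose fE L₂ hL₂ hmaps using fun e =>
    exists_edge_mapsOnto_of_isQuasiGeometric h37iv h𝒢 hℋ c𝒢 cℋ hφ (hL₀ e) (hL₀0 e)
  -- any edge-like subgroup at `e` goes to the same edge
  have hall : ∀ (e : 𝒢.graph.Edge) (L : Subgroup c𝒢.G), L ∈ edgeLikeSubgroups c𝒢 e →
      ∃ L₂' ∈ edgeLikeSubgroups cℋ (fE e), MapsOntoOpenSubgroupOf φ.toMonoidHom L L₂' := by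
    intro e L hL
    obtain ⟨g, rfl⟩ := exists_conj_of_mem_edgeLikeSubgroups c𝒢 (hL₀ e) hL
    have hL0 : (L₀ e).map (MulAut.conj g).toMonoidHom ≠ ⊥ := fun h0 =>
      hL₀0 e ((Subgroup.map_eq_bot_iff_of_injective _ (MulAut.conj g).injective).mp h0)
    obtain ⟨e', L₂', hL₂', hmaps'⟩ :=
      exists_edge_mapsOnto_of_isQuasiGeometric h37iv h𝒢 hℋ c𝒢 cℋ hφ hL hL0
    have hle : ((L₀ e).map (MulAut.conj g).toMonoidHom).map φ.toMonoidHom ≤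
        (L₂ e).map (MulAut.conj (φ g)).toMonoidHom := by
      rintro _ ⟨_, ⟨k, hk, rfl⟩, rfl⟩
      refine ⟨φ k, (hmaps e).1 ⟨k, hk, rfl⟩, ?_⟩
      change φ g * φ k * (φ g)⁻¹ = φ (g * k * g⁻¹)
      rw [map_mul, map_mul, map_inv]
    have he : e' = fE e :=
      edge_eq_of_mapsOnto_of_le hED hℋ.thm37Hypotheses cℋ φ.toMonoidHom hL₂'
        (conj_mem_edgeLikeSubgroups' cℋ (hL₂ e) (φ g)) hmaps' hle
    subst he
    exact ⟨L₂', hL₂', hmaps'⟩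
  refine ⟨fE, hall, fun fE' hfE' => funext fun e => ?_⟩
  obtain ⟨L₂', hL₂', hmaps'⟩ := hfE' e (L₀ e) (hL₀ e)
  exact edge_eq_of_mapsOnto_of_le hED hℋ.thm37Hypotheses cℋ φ.toMonoidHom hL₂' (hL₂ e) hmaps'
    (hmaps e).1

end ProfiniteSemiGraph

end Literature.AnabelianGeometry.SemiGraphs
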